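import Summits.QuantumFields.YangMills.Theorems.ParabolicTrajectoryLatticeGapOnTrajectoryTransferFromOSGap
import Summits.QuantumFields.YangMills.Theorems.ParabolicTrajectoryLatticeGapOnTrajectoryStubTransferSymSteps
import Literature.MathematicalPhysics.QuantumFieldTheory.SpeciesLatticeSupBounds
import HarnessLib

/-!
# Crux `LatticeGapOnTrajectory` (stmt-QuantumFields-10523), line `orbit-kantorovich-finite-size`
# (reshape 4b): the symmetric transfer from slab clustering, ONE scheme (lead c2)

Helper file (`--supports stmt-QuantumFields-10523`; registered helper stub
`hasMassGap_of_slabClustering`). For an `M`-adic scheme with `β_k → ∞`, physical volume `a_k L_k`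
outgrowing `log(1/a_k)`, site reflection positivity of the odd tori (raw strict form of the registered
`stub_negReflectRP`), slab clustering in cluster-expansion format at rate `Δ` on the scheme's own tori
(the conclusion of the registered `stub_slabClustering`) and reflection-symmetric, polynomially bounded
renormalisations, every OS datum `T` with `IsYangMillsFor r S T` has `T.HasMassGap Δ` — same rate.
Proof: density reduction `Transfer.hasMassGap_of_dense_clustering` (slab sums, `M`-adic times); at
step `k` the cross bound `norm_osCorr_cross_le_of_far` (Hankel chain of depth
`J_k = log₂⌊(L_k−1−2w_k)/m_k⌋` + multiplicative polarisation) with the far bound supplied by slab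
clustering; as `k → ∞`, `2^{J_k} ≳ a_k L_k → ∞` (`volume_le_two_pow_depth`) and
`2^{−J_k} log C_k → 0` (`hankel_constant_growth`, `SymHelpers.tendsto_log_div_of_growth`), so the
prefactor tends to `2(V_F + V_{G'})` (`tendsto_pow_pred_mul_rpow_inv`) while the correlation tends to
the truncated Schwinger function (`tendsto_osCorr_rep`, `tendsto_osVar_rep`). The registered stub
`stub_transferSym` (all `sch' ~ sch`) is the next file.
References: Osterwalder–Seiler 1978 §2; Glimm–Jaffe 1987 §6.1, §19.7; Fröhlich–Israel–Lieb–Simon 1978 §2.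
-/

open scoped SchwartzMap Topology ComplexConjugate ComplexOrder
open Filter Set MeasureTheory
open Literature.MathematicalPhysics.AQFT Literature.MathematicalPhysics.QuantumLattice
open Literature.MathematicalPhysics.QuantumFieldTheory

noncomputable section

namespace Summit.QuantumFields.YangMills.Cruxes.LatticeGapOnTrajectory.OrbitKantorovichFiniteSize

namespace Transfer

variable {G : Type} [Group G] [TopologicalSpace G] [IsTopologicalGroup G] [CompactSpace G]
  [MeasurableSpace G] [BorelSpace G]

/-! ## The symmetric transfer, one scheme -/

/-- **The symmetric transfer from slab clustering, one scheme.** For an `M`-adic scheme `S`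
(`a_k = M^{-n_k}`, `M ≥ 2`) with `β_k → ∞`, `a_k L_k / log(a_k⁻¹) → ∞`, reflection-symmetric and
polynomially bounded renormalisations, site reflection positivity of the odd Wilson tori on slab
observables, and slab clustering in cluster-expansion format at rate `Δ` on the scheme's tori, every
OS datum `T` with `IsYangMillsFor r S T` has `T.HasMassGap Δ`.
[cite: GlimmJaffe1987, §6.1 and §19.7] [cite: OsterwalderSeiler1978, §2] [cite: FrohlichIsraelLiebSimon1978, §2] -/
theorem hasMassGap_of_slabClustering (r : LatticeRep G) {M : ℕ} {S : SpeciesScheme (YMSpecies G)}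
    {n : ℕ → ℕ} {Δ : ℝ} (hM : 2 ≤ M) (hshape : ∀ k, S.a k = ((M : ℝ) ^ n k)⁻¹)
    (hβ : Tendsto S.β atTop atTop)
    (hvol : Tendsto (fun k => S.a k * S.L k / Real.log (S.a k)⁻¹) atTop atTop)
    (hRP : ∀ {β : ℝ}, 0 ≤ β → ∀ {Sh : ℕ}, 1 ≤ Sh → ∀ (F : GaugeConfig 4 (2 * Sh + 1) G → ℂ), Measurable F →
      (∃ C : ℝ, ∀ U, ‖F U‖ ≤ C) → ∀ {w : ℕ}, w < Sh →
      DependsOn F {e : Edge 4 (2 * Sh + 1) | 1 ≤ (e.1 0).val ∧ (e.1 0).val ≤ w} →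
        0 ≤ wilsonExpectation r.ρ β fun U => conj (F U.negReflect) * F U)
    (hclust : ∃ (p : ℕ) (K : ℝ), 0 ≤ K ∧ ∀ᶠ k in atTop,
      ∀ (w N : ℕ) (X : GaugeConfig 4 (S.side k) G → ℂ) (B : ℝ), Measurable X → (∀ U, ‖X U‖ ≤ B) →
        DependsOn X {e : Edge 4 (S.side k) | 1 ≤ (e.1 0).val ∧ (e.1 0).val ≤ w} →
        N + 2 * w ≤ S.L k →
          ‖osCorr (wilsonMeasure r.ρ (S.β k)) GaugeConfig.negReflect (torusTimeShift (S.side k) N) X X‖ ≤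
            K * ((S.a k)⁻¹ * ((w : ℝ) + 1) * ((S.L k : ℝ) + 1)) ^ p * B ^ 2 *
              Real.exp (-Δ * S.a k * N))
    (hsym : S.IsReflectionSymmetric)
    (hpoly : ∀ s, ∃ (q : ℕ) (K : ℝ), ∀ k,
      |S.c s k| ≤ K * ((S.a k)⁻¹) ^ q ∧ |S.m s k| ≤ K * ((S.a k)⁻¹) ^ q)
    {T : OSData (YMSpecies G) 4} (hT : IsYangMillsFor r S T) : T.HasMassGap Δ := by
  -- adapted from `…TransferFromOSGapSlack` (`hasMassGap_of_torusOSGapSlack`); Hankel bound instead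
  have hV : ∀ (p : ℕ) (l₁ : Fin (p + p) → YMSpecies G) (l₂ l₃ : Fin p → YMSpecies G),
      Continuous fun F : 𝓢((Fin p → EuclideanSpace ℝ (Fin 4)), ℂ) =>
        (T.schwinger (p + p) l₁ ((osAdjoint F).appendTensor F) -
          T.schwinger p l₂ (osAdjoint F) * T.schwinger p l₃ F).re := fun p l₁ l₂ l₃ =>
    Complex.continuous_re.comp ((((T.schwinger (p + p) l₁).continuous.comp
      (continuous_appendTensor.comp (continuous_osAdjoint.prodMk continuous_id))).sub
      (((T.schwinger p l₂).continuous.comp continuous_osAdjoint).mul (T.schwinger p l₃).continuous)))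
  obtain ⟨p, Kc, hKc0, hcl⟩ := hclust
  refine hasMassGap_of_dense_clustering T Δ
    (fun p => (Submodule.span ℂ (slabOrderedProducts 4 p) : Set _))
    (fun p F hF => hF.mem_closure_span_slabOrderedProducts) _ (dense_MAdic hM)
    (fun p q σ σ' F G' => 2 * ((T.schwinger (p + p) (Fin.append (σ ∘ Fin.rev)
        (fun i => (σ i).timeReflect)) ((osAdjoint F).appendTensor F) -
        T.schwinger p (σ ∘ Fin.rev) (osAdjoint F) * T.schwinger p (fun i => (σ i).timeReflect) F).re +
      (T.schwinger (q + q) (Fin.append ((fun j => (σ' j).timeReflect) ∘ Fin.rev) σ')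
        ((osAdjoint G').appendTensor G') -
        T.schwinger q ((fun j => (σ' j).timeReflect) ∘ Fin.rev) (osAdjoint G') *
          T.schwinger q σ' G').re))
    (fun p q σ σ' => continuous_const.mul (((hV p _ _ _).comp continuous_fst).add
      ((hV q _ _ _).comp continuous_snd)))
    (fun nn mm σ σ' F G' hF hG' t ht ht0 => ?_)
  obtain ⟨D, rfl⟩ := SlabSum.exists_of_mem_span hF
  obtain ⟨D', rfl⟩ := SlabSum.exists_of_mem_span hG'
  obtain ⟨i₀, j, rfl⟩ := ht
  have hM0 : (0 : ℝ) < M := by exact_mod_cast lt_of_lt_of_le (by norm_num) hM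
  have hMi : (0 : ℝ) < (M : ℝ) ^ i₀ := pow_pos hM0 i₀
  have hj : (0 : ℤ) ≤ j := by
    by_contra hneg
    push Not at hneg
    have : (j : ℝ) / (M : ℝ) ^ i₀ < 0 := div_neg_of_neg_of_pos (by exact_mod_cast hneg) hMi
    linarith
  obtain ⟨jn, rfl⟩ := Int.eq_ofNat_of_zero_le hj
  set t : ℝ := ((jn : ℤ) : ℝ) / (M : ℝ) ^ i₀ with htdef
  set m : ℕ → ℕ := fun k => jn * M ^ (n k - i₀) with hmdef
  have hs : ∀ᶠ k in atTop, S.a k * ((m k : ℕ) : ℝ) = t := by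
    filter_upwards [(tendsto_n_of_shape S hM hshape).eventually_ge_atTop i₀] with k hk
    rw [hshape k, htdef, hmdef]
    push_cast
    rw [pow_sub₀ _ hM0.ne' hk]
    field_simp
  have hcorr := tendsto_osCorr_rep r hT hsym D D' (fun i => (σ i).timeReflect) σ' ht0 hs
  have hvarF := tendsto_osVar_rep r hT hsym D (fun i => (σ i).timeReflect)
  have hvarG := tendsto_osVar_rep r hT hsym D' σ'
  simp only [LocalGaugeObservable.timeReflect_timeReflect] at hcorr hvarF
  obtain ⟨qF, KF, hKF0, hKF⟩ :=
    D.exists_norm_rep_le_pow S (fun i => (σ i).timeReflect) fun i => hpoly _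
  obtain ⟨qG, KG, hKG0, hKG⟩ := D'.exists_norm_rep_le_pow S σ' fun j => hpoly _
  obtain ⟨loF, hloF, hloF'⟩ := exists_pos_le_lo D
  obtain ⟨loG, hloG, hloG'⟩ := exists_pos_le_lo D'
  obtain ⟨hiF, hhiF, hhiF'⟩ := exists_hi_le D
  obtain ⟨hiG, hhiG, hhiG'⟩ := exists_hi_le D'
  set R : ℕ := (Finset.univ.sup fun i => timeRadius (σ i).timeReflect) ⊔
    (Finset.univ.sup fun j => timeRadius (σ' j)) with hR
  have hRF : ∀ i, timeRadius (σ i).timeReflect ≤ R := fun i =>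
    (Finset.le_sup (f := fun i => timeRadius (σ i).timeReflect) (Finset.mem_univ i)).trans le_sup_left
  have hRG : ∀ j, timeRadius (σ' j) ≤ R := fun j =>
    (Finset.le_sup (f := fun j => timeRadius (σ' j)) (Finset.mem_univ j)).trans le_sup_right
  set lo₀ := min loF loG with hlo₀
  set hi₀ := max hiF hiG with hhi₀
  have hlo₀pos : 0 < lo₀ := lt_min hloF hloG
  have hhi₀0 : 0 ≤ hi₀ := hhiF.trans (le_max_left _ _)
  have hR0 : (0 : ℝ) ≤ R := Nat.cast_nonneg R
  -- the k-dependent window, dyadic depth, sup bound, constant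
  obtain ⟨w, hwdef⟩ : ∃ w : ℕ → ℕ, w = fun k => ⌈hi₀ / S.a k⌉₊ + R := ⟨_, rfl⟩
  obtain ⟨J, hJdef⟩ : ∃ J : ℕ → ℕ, J = fun k => if jn = 0 then Nat.log 2 (S.L k) + 1
    else Nat.log 2 ((S.L k - 1 - 2 * w k) / m k) := ⟨_, rfl⟩
  obtain ⟨Bk, hBkdef⟩ : ∃ Bk : ℕ → ℝ, Bk = fun k => (KF + KG) * (S.a k)⁻¹ ^ (qF + qG) := ⟨_, rfl⟩
  obtain ⟨C, hCdef⟩ : ∃ C : ℕ → ℝ, C = fun k =>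
      (Kc + 1) * ((S.a k)⁻¹ * ((w k : ℝ) + 1) * ((S.L k : ℝ) + 1)) ^ p * ((Bk k + Bk k) ^ 2 + 1) :=
    ⟨_, rfl⟩
  set vF : ℝ := (T.schwinger (nn + nn) (Fin.append (σ ∘ Fin.rev) fun i => (σ i).timeReflect)
      ((osAdjoint D.sum).appendTensor D.sum) -
    T.schwinger nn (σ ∘ Fin.rev) (osAdjoint D.sum) *
      T.schwinger nn (fun i => (σ i).timeReflect) D.sum).re with hvF
  set vG : ℝ := (T.schwinger (mm + mm) (Fin.append ((fun j => (σ' j).timeReflect) ∘ Fin.rev) σ')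
      ((osAdjoint D'.sum).appendTensor D'.sum) -
    T.schwinger mm ((fun j => (σ' j).timeReflect) ∘ Fin.rev) (osAdjoint D'.sum) *
      T.schwinger mm σ' D'.sum).re with hvG
  have hvarF' : Tendsto (fun k => osVar (wilsonMeasure r.ρ (S.β k)) GaugeConfig.negReflect
      (D.rep S (fun i => (σ i).timeReflect) k)) atTop (𝓝 vF) := hvarF
  have hvarG' : Tendsto (fun k => osVar (wilsonMeasure r.ρ (S.β k)) GaugeConfig.negReflect
      (D'.rep S σ' k)) atTop (𝓝 vG) := hvarG
  -- basic eventual facts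
  have e3 : ∀ᶠ k in atTop, S.a k ≤ lo₀ / (R + 1) :=
    S.tendsto_a.eventually_le_const (by positivity)
  have e4 : ∀ᶠ k in atTop, S.a k ≤ 1 := S.tendsto_a.eventually_le_const one_pos
  have e5 : ∀ᶠ k in atTop, t + 2 * hi₀ + 2 * (R + 2) ≤ S.a k * S.L k :=
    S.tendsto_L.eventually_ge_atTop _
  have e6 : ∀ᶠ k in atTop, 0 ≤ S.β k := hβ.eventually_ge_atTop 0
  -- the window fits strictly: `m + 2w + 1 ≤ L`, `L ≥ 1`, `w ≤ hi₀/a + 1 + R`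
  have hGoodData : ∀ᶠ k in atTop, m k + 2 * w k + 1 ≤ S.L k ∧ 1 ≤ S.L k ∧
      (w k : ℝ) ≤ hi₀ / S.a k + 1 + R := by
    filter_upwards [hs, e4, e5] with k hk2 hk4 hk5
    have ha := S.a_pos k
    have hw2 : (w k : ℝ) ≤ hi₀ / S.a k + 1 + R := by
      have h1 := Nat.ceil_lt_add_one (div_nonneg hhi₀0 ha.le : 0 ≤ hi₀ / S.a k)
      simp only [hwdef, Nat.cast_add]
      linarith only [h1]
    have hsw : m k + 2 * w k + 1 ≤ S.L k := by
      have h1 : ((m k : ℕ) : ℝ) = t / S.a k := by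
        rw [eq_div_iff ha.ne', mul_comm, hk2]
      have h2 : t / S.a k + 2 * (hi₀ / S.a k + 1 + R) + 1 ≤ S.L k := by
        refine le_of_mul_le_mul_left ?_ ha
        have h4 : S.a k * (t / S.a k + 2 * (hi₀ / S.a k + 1 + R) + 1) =
            t + 2 * hi₀ + S.a k * (2 * (1 + R) + 1) := by
          field_simp
          ring
        rw [h4]
        nlinarith [mul_le_mul_of_nonneg_right hk4 (by positivity : (0 : ℝ) ≤ 2 * (1 + R) + 1)]
      have h3 : ((m k : ℕ) : ℝ) + 2 * (w k : ℝ) + 1 ≤ S.L k := by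
        rw [h1]; linarith only [h2, hw2]
      exact_mod_cast h3
    have hL1 : 1 ≤ S.L k := by omega
    exact ⟨hsw, hL1, hw2⟩
  have htpos_of : jn ≠ 0 → 0 < t := fun hjn => by
    have : (0 : ℝ) < ((jn : ℤ) : ℝ) := by exact_mod_cast Nat.pos_of_ne_zero hjn
    exact div_pos this hMi
  -- the dyadic depth fits (strictly) and grows linearly with the physical volume
  have hJfit : ∀ᶠ k in atTop, 2 ^ J k * m k + 2 * w k + 1 ≤ S.L k := by
    filter_upwards [hGoodData] with k ⟨hsw, hL1, _⟩
    by_cases hjn : jn = 0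
    · have hm0 : m k = 0 := by simp [hmdef, hjn]
      rw [hm0, mul_zero, zero_add]
      omega
    · have hmpos : 0 < m k := Nat.mul_pos (Nat.pos_of_ne_zero hjn) (pow_pos (by omega) _)
      have hsw' : m k + 2 * w k ≤ S.L k - 1 := by omega
      have h := (SymHelpers.pow_log_window hmpos hsw').1
      simp only [hJdef, hjn, ↓reduceIte]
      omega
  obtain ⟨cN, hcN⟩ : ∃ cN : ℝ, cN = if jn = 0 then 1 else 1 / (4 * t) := ⟨_, rfl⟩
  have hcNpos : 0 < cN := by
    by_cases hjn : jn = 0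
    · simp [hcN, hjn]
    · have := htpos_of hjn
      simp only [hcN, hjn, ↓reduceIte]
      positivity
  have e5' : ∀ᶠ k in atTop, 4 * (hi₀ + 1 + R) + 2 * t + 2 ≤ S.a k * S.L k :=
    S.tendsto_L.eventually_ge_atTop _
  have hNlow : ∀ᶠ k in atTop, cN * (S.a k * S.L k) ≤ ((2 ^ J k : ℕ) : ℝ) := by
    filter_upwards [hGoodData, hs, e4, e5'] with k ⟨hsw, hL1, hw2⟩ hk2 hk4 hk5
    have ha := S.a_pos k
    by_cases hjn : jn = 0
    · simp only [hJdef, hjn, ↓reduceIte, hcN, one_mul]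
      have h1 : S.L k < 2 ^ (Nat.log 2 (S.L k) + 1) := Nat.lt_pow_succ_log_self (by norm_num) _
      have h2 : S.a k * S.L k ≤ S.L k := by
        simpa using mul_le_mul_of_nonneg_right hk4 (Nat.cast_nonneg (S.L k))
      exact h2.trans (by exact_mod_cast h1.le)
    · have hmpos : 0 < m k := Nat.mul_pos (Nat.pos_of_ne_zero hjn) (pow_pos (by omega) _)
      have htpos := htpos_of hjn
      have haw : S.a k * (w k : ℝ) ≤ hi₀ + 1 + R := by
        have h1 := mul_le_mul_of_nonneg_left hw2 ha.le
        rw [show S.a k * (hi₀ / S.a k + 1 + R) = hi₀ + S.a k * (1 + R) by field_simp; ring] at h1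
        nlinarith [h1, hk4, hR0]
      have h := volume_le_two_pow_depth ha hk4 htpos hmpos hk2 haw
        (by omega : m k + 2 * w k ≤ S.L k - 1) hL1 hk5
      simp only [hJdef, hjn, ↓reduceIte, hcN]
      rw [div_mul_eq_mul_div, one_mul]
      push_cast
      exact h
  have hNtend : Tendsto (fun k => 2 ^ J k) atTop atTop := by
    have h1 : Tendsto (fun k => cN * (S.a k * S.L k)) atTop atTop :=
      S.tendsto_L.const_mul_atTop hcNpos
    exact tendsto_natCast_atTop_iff.1 (tendsto_atTop_mono' atTop hNlow h1)
  -- growth of the constant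
  have hCgrow : ∀ᶠ k in atTop, 1 ≤ C k ∧ Real.log (C k) ≤
      Real.log ((Kc + 1) * (2 * (hi₀ + 2 + R)) ^ p * (4 * (KF + KG) ^ 2 + 1)) +
        (((3 * p + 2 * (qF + qG) : ℕ) : ℝ) + (p : ℝ)) * (Real.log (S.a k)⁻¹ + Real.log (S.a k * S.L k)) := by
    filter_upwards [hGoodData, e4, S.tendsto_L.eventually_ge_atTop 1] with k ⟨_, hL1, hw2⟩ hk4 hu1
    have h := hankel_constant_growth (KFG := KF + KG) (p := p) (q := qF + qG) hKc0 hhi₀0 hR0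
      (S.a_pos k) hk4 hL1 hu1 hw2
    simpa only [hCdef, hBkdef] using h
  have hC1 : ∀ᶠ k in atTop, 1 ≤ C k := hCgrow.mono fun k h => h.1
  have hCle := hCgrow.mono fun k h => h.2
  have hℓ0 : ∀ᶠ k in atTop, 0 ≤ Real.log (S.a k)⁻¹ := by
    filter_upwards [e4] with k hk4
    exact Real.log_nonneg ((one_le_inv₀ (S.a_pos k)).2 hk4)
  have hℓ : Tendsto (fun k => Real.log (S.a k)⁻¹ / (S.a k * S.L k)) atTop (𝓝 0) := by
    have h := tendsto_inv_atTop_zero.comp hvol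
    refine h.congr' (Eventually.of_forall fun k => ?_)
    simp [inv_div]
  have hCt := SymHelpers.tendsto_log_div_of_growth (Nn := fun k => 2 ^ J k) hcNpos S.tendsto_L hℓ0 hℓ
    hC1 hCle hNlow
  have hCpos : ∀ k, 0 < C k := fun k => by
    have ha := S.a_pos k
    rw [hCdef]
    positivity
  -- nonnegativity of the OS variances (site RP), eventually; the limit of the right-hand side
  have hVnn : ∀ᶠ k in atTop,
      0 ≤ osVar (wilsonMeasure r.ρ (S.β k)) GaugeConfig.negReflect (D.rep S (fun i => (σ i).timeReflect) k) ∧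
      0 ≤ osVar (wilsonMeasure r.ρ (S.β k)) GaugeConfig.negReflect (D'.rep S σ' k) := by
    filter_upwards [hGoodData, e3, e6] with k ⟨hsw, hL1, _⟩ hk3 hk6
    have ha := S.a_pos k
    have hwside : w k < S.side k := by simp only [SpeciesScheme.side]; omega
    have hwS : w k < S.L k := by omega
    have hk3' : S.a k * (R + 1) ≤ lo₀ := (le_div_iff₀ (by linarith only [hR0])).1 hk3
    have hw1 : hi₀ + S.a k * R ≤ S.a k * w k := by
      have h2 : hi₀ / S.a k ≤ ⌈hi₀ / S.a k⌉₊ := Nat.le_ceil _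
      rw [div_le_iff₀ ha] at h2
      simp only [hwdef, Nat.cast_add]
      linarith only [h2]
    have hdF := D.dependsOn_rep S (fun i => (σ i).timeReflect) k hRF
      (fun i j' => hk3'.trans ((min_le_left _ _).trans (hloF' i j')))
      (fun i j' => by linarith only [hhiF' i j', le_max_left hiF hiG, hw1, hhi₀]) hwside
    have hdG := D'.dependsOn_rep S σ' k hRG
      (fun i j' => hk3'.trans ((min_le_right _ _).trans (hloG' i j')))
      (fun i j' => by linarith only [hhiG' i j', le_max_right hiF hiG, hw1, hhi₀]) hwside
    have hRPk : ∀ (F : GaugeConfig 4 (2 * S.L k + 1) G → ℂ), Measurable F → (∃ C : ℝ, ∀ U, ‖F U‖ ≤ C) →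
        ∀ {w : ℕ}, w < S.L k →
          DependsOn F {e : Edge 4 (2 * S.L k + 1) | 1 ≤ (e.1 0).val ∧ (e.1 0).val ≤ w} →
            0 ≤ wilsonExpectation r.ρ (S.β k) fun U => conj (F U.negReflect) * F U :=
      fun F hF hFb _ hw hdep => hRP hk6 hL1 F hF hFb hw hdep
    exact ⟨HankelSite.osVar_negReflect_nonneg_of_rp_lt r.ρ r.continuous (S.β k) (S := S.L k) hRPk
        (D.measurable_rep S _ k) (D.exists_bound_rep S _ k) hwS hdF,
      HankelSite.osVar_negReflect_nonneg_of_rp_lt r.ρ r.continuous (S.β k) (S := S.L k) hRPk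
        (D'.measurable_rep S _ k) (D'.exists_bound_rep S _ k) hwS hdG⟩
  have hvF0 : 0 ≤ vF := ge_of_tendsto hvarF' (hVnn.mono fun k h => h.1)
  have hvG0 : 0 ≤ vG := ge_of_tendsto hvarG' (hVnn.mono fun k h => h.2)
  obtain ⟨V', hV'def⟩ : ∃ V' : ℕ → ℝ, V' = fun k => max 0 (2 *
    (osVar (wilsonMeasure r.ρ (S.β k)) GaugeConfig.negReflect (D.rep S (fun i => (σ i).timeReflect) k) +
      osVar (wilsonMeasure r.ρ (S.β k)) GaugeConfig.negReflect (D'.rep S σ' k))) := ⟨_, rfl⟩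
  have hV't : Tendsto V' atTop (𝓝 (2 * (vF + vG))) := by
    have h := (tendsto_const_nhds (x := (0 : ℝ))).max ((hvarF'.add hvarG').const_mul 2)
    rw [max_eq_right (by linarith only [hvF0, hvG0])] at h
    rw [hV'def]
    exact h
  have hV'0 : ∀ k, 0 ≤ V' k := fun k => by rw [hV'def]; exact le_max_left _ _
  have hlim : Tendsto (fun k => (V' k ^ (2 ^ J k - 1) * C k) ^ (((2 ^ J k : ℕ) : ℝ)⁻¹) * Real.exp (-Δ * t))
      atTop (𝓝 (2 * (vF + vG) * Real.exp (-Δ * t))) :=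
    (tendsto_pow_pred_mul_rpow_inv hV'0 hV't hNtend hCpos hCt).mul_const _
  refine le_of_tendsto_of_tendsto ((continuous_norm.tendsto _).comp hcorr) hlim ?_
  -- the eventual lattice inequality: Hankel chain + multiplicative polarisation (`norm_osCorr_cross_le_of_far`)
  filter_upwards [hcl, hs, e3, e4, e6, hGoodData, hJfit] with k hclk hk2 hk3 hk4 hk6 ⟨hsw, hL1, hw2⟩ hJk
  have ha := S.a_pos k
  have hwside : w k < S.side k := by simp only [SpeciesScheme.side]; omega
  have hwS : w k < S.L k := by omega
  have hA1 : 1 ≤ (S.a k)⁻¹ := (one_le_inv₀ ha).2 hk4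
  have hinv0 : 0 ≤ (S.a k)⁻¹ := inv_nonneg.2 ha.le
  -- sup bounds of the representatives
  have hBF : ∀ U, ‖D.rep S (fun i => (σ i).timeReflect) k U‖ ≤ Bk k := fun U => by
    rw [hBkdef]
    exact (hKF k hk4 U).trans (mul_le_mul (le_add_of_nonneg_right hKG0)
      (pow_le_pow_right₀ hA1 (Nat.le_add_right _ _)) (pow_nonneg hinv0 _) (add_nonneg hKF0 hKG0))
  have hBG : ∀ U, ‖D'.rep S σ' k U‖ ≤ Bk k := fun U => by
    rw [hBkdef]
    exact (hKG k hk4 U).trans (mul_le_mul (le_add_of_nonneg_left hKF0)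
      (pow_le_pow_right₀ hA1 (Nat.le_add_left _ _)) (pow_nonneg hinv0 _) (add_nonneg hKF0 hKG0))
  have hBk0 : 0 ≤ Bk k := by
    have h := mul_nonneg (add_nonneg hKF0 hKG0) (pow_nonneg hinv0 (qF + qG))
    simpa only [hBkdef] using h
  -- supports of the representatives
  have hk3' : S.a k * (R + 1) ≤ lo₀ := (le_div_iff₀ (by linarith only [hR0])).1 hk3
  have hw1 : hi₀ + S.a k * R ≤ S.a k * w k := by
    have h2 : hi₀ / S.a k ≤ ⌈hi₀ / S.a k⌉₊ := Nat.le_ceil _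
    rw [div_le_iff₀ ha] at h2
    simp only [hwdef, Nat.cast_add]
    linarith only [h2]
  have hdF := D.dependsOn_rep S (fun i => (σ i).timeReflect) k hRF
    (fun i j' => hk3'.trans ((min_le_left _ _).trans (hloF' i j')))
    (fun i j' => by linarith only [hhiF' i j', le_max_left hiF hiG, hw1, hhi₀]) hwside
  have hdG := D'.dependsOn_rep S σ' k hRG
    (fun i j' => hk3'.trans ((min_le_right _ _).trans (hloG' i j')))
    (fun i j' => by linarith only [hhiG' i j', le_max_right hiF hiG, hw1, hhi₀]) hwside
  -- the site-RP hypothesis at this `k`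
  have hRPk : ∀ (F : GaugeConfig 4 (2 * S.L k + 1) G → ℂ), Measurable F → (∃ C : ℝ, ∀ U, ‖F U‖ ≤ C) →
      ∀ {w : ℕ}, w < S.L k →
        DependsOn F {e : Edge 4 (2 * S.L k + 1) | 1 ≤ (e.1 0).val ∧ (e.1 0).val ≤ w} →
          0 ≤ wilsonExpectation r.ρ (S.β k) fun U => conj (F U.negReflect) * F U :=
    fun F hF hFb _ hw hdep => hRP hk6 hL1 F hF hFb hw hdep
  -- the far bound at this `k`, constant `(Kc + 1) P_k (B² + 1)`
  have hw0 : (0 : ℝ) ≤ (w k : ℝ) + 1 := by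
    have := (Nat.cast_nonneg (w k) : (0 : ℝ) ≤ _); linarith only [this]
  have hL0 : (0 : ℝ) ≤ (S.L k : ℝ) + 1 := by
    have := (Nat.cast_nonneg (S.L k) : (0 : ℝ) ≤ _); linarith only [this]
  have hP0 : 0 ≤ ((S.a k)⁻¹ * ((w k : ℝ) + 1) * ((S.L k : ℝ) + 1)) ^ p :=
    pow_nonneg (mul_nonneg (mul_nonneg hinv0 hw0) hL0) p
  have hKf0 : 0 ≤ (Kc + 1) * ((S.a k)⁻¹ * ((w k : ℝ) + 1) * ((S.L k : ℝ) + 1)) ^ p :=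
    mul_nonneg (by linarith only [hKc0]) hP0
  have hfar : ∀ (Z : GaugeConfig 4 (2 * S.L k + 1) G → ℂ) (B : ℝ), Measurable Z → (∀ U, ‖Z U‖ ≤ B) →
      DependsOn Z {e : Edge 4 (2 * S.L k + 1) | 1 ≤ (e.1 0).val ∧ (e.1 0).val ≤ w k} →
        ‖osCorr (wilsonMeasure (d := 4) (L := 2 * S.L k + 1) r.ρ (S.β k)) GaugeConfig.negReflect
            (torusTimeShift (2 * S.L k + 1) (2 ^ J k * m k)) Z Z‖ ≤
          (Kc + 1) * ((S.a k)⁻¹ * ((w k : ℝ) + 1) * ((S.L k : ℝ) + 1)) ^ p * (B ^ 2 + 1) *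
            Real.exp (-(Δ * S.a k * (2 ^ J k * m k))) := by
    intro Z B hZ hB hZd
    have h := hclk (w k) (2 ^ J k * m k) Z B hZ hB hZd (by omega)
    refine h.trans ?_
    have hexp : Real.exp (-Δ * S.a k * ((2 ^ J k * m k : ℕ) : ℝ)) =
        Real.exp (-(Δ * S.a k * (2 ^ J k * m k))) := by
      congr 1; push_cast; ring
    rw [hexp]
    refine mul_le_mul_of_nonneg_right ?_ (Real.exp_pos _).le
    have hB0 := sq_nonneg B
    linarith only [mul_nonneg hKc0 hP0, mul_nonneg hP0 hB0, hP0]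
  have hcross := norm_osCorr_cross_le_of_far r.ρ r.continuous (S.β k) (S := S.L k) hRPk
    (by omega : 2 ^ J k * m k + w k < S.L k) hKf0 hfar
    (D.measurable_rep S (fun i => (σ i).timeReflect) k) (D'.measurable_rep S σ' k) hBk0 hBk0 hBF hBG
    hdF hdG
  -- re-read the bound with the torus side spelled `S.side k` (definitionally `2 L_k + 1`)
  have hcross' : ‖osCorr (wilsonMeasure r.ρ (S.β k)) GaugeConfig.negReflect (torusTimeShift (S.side k) (m k))
      (D.rep S (fun i => (σ i).timeReflect) k) (D'.rep S σ' k)‖ ≤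
      ((2 * (osVar (wilsonMeasure r.ρ (S.β k)) GaugeConfig.negReflect (D.rep S (fun i => (σ i).timeReflect) k) +
            osVar (wilsonMeasure r.ρ (S.β k)) GaugeConfig.negReflect (D'.rep S σ' k))) ^ (2 ^ J k - 1) *
          ((Kc + 1) * ((S.a k)⁻¹ * ((w k : ℝ) + 1) * ((S.L k : ℝ) + 1)) ^ p * ((Bk k + Bk k) ^ 2 + 1))) ^
          ((2 ^ J k : ℝ)⁻¹) * Real.exp (-(Δ * S.a k * m k)) := hcross
  refine hcross'.trans (le_of_eq ?_)
  have hVF0 : 0 ≤ osVar (wilsonMeasure r.ρ (S.β k)) GaugeConfig.negReflect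
      (D.rep S (fun i => (σ i).timeReflect) k) :=
    HankelSite.osVar_negReflect_nonneg_of_rp_lt r.ρ r.continuous (S.β k) (S := S.L k) hRPk
      (D.measurable_rep S (fun i => (σ i).timeReflect) k) (D.exists_bound_rep S _ k) hwS hdF
  have hVG0 : 0 ≤ osVar (wilsonMeasure r.ρ (S.β k)) GaugeConfig.negReflect (D'.rep S σ' k) :=
    HankelSite.osVar_negReflect_nonneg_of_rp_lt r.ρ r.continuous (S.β k) (S := S.L k) hRPk
      (D'.measurable_rep S σ' k) (D'.exists_bound_rep S _ k) hwS hdG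
  have hV'k : V' k = 2 * (osVar (wilsonMeasure r.ρ (S.β k)) GaugeConfig.negReflect
      (D.rep S (fun i => (σ i).timeReflect) k) +
        osVar (wilsonMeasure r.ρ (S.β k)) GaugeConfig.negReflect (D'.rep S σ' k)) := by
    simp only [hV'def]
    exact max_eq_right (by linarith only [hVF0, hVG0])
  have hexp2 : Real.exp (-(Δ * S.a k * (m k : ℕ))) = Real.exp (-Δ * t) := by
    congr 1; rw [← hk2]; ring
  rw [hV'k, hexp2, hCdef]
  push_cast
  ring

end Transfer

end Summit.QuantumFields.YangMills.Cruxes.LatticeGapOnTrajectory.OrbitKantorovichFiniteSize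

end
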